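import Literature.MathematicalPhysics.QuantumFieldTheory.Balaban1983to89.Node00.SmallFieldChiOfRecord
import Literature.MathematicalPhysics.QuantumFieldTheory.Balaban1983to89.B15DeterminingSetsB

/-!
# NODE 00 — FILE 1ᴮ: the (2.12) solution map of record OVER A BOND-LEVEL DETERMINING DATUM (`UminOfRecordB`, `solvableDomB`, `SelSpecB`, `bgOfRecordB`)

Cell `pub-ymgap`, seat `pub-ymgap-node00-def-R` (g22), (E1) variant (iii-b) of record (director-ym №338 ∕ №339 (α) ∕ №341 ∕ №342), WORKPLAN-IIIB
27c850bec22d4efe STAGE 2, additive part S2a.  [III] = [Balaban1988Convergent], [15] = [Balaban1985Variational], [II] = [Balaban1984PropagatorsII].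

WHAT.  The print-datum twin of `Node00/SmallFieldChiOfRecord.lean` §2 (FILE 1, `solvableDom ∕ SelSpec ∕ UminOfRecord ∕ bgOfRecord` :86–:211): the SAME
total solution map of the variational problem [III] (2.12) p. 256 — *"we consider the variational problem … for U regular … with the conditions
M(U) = V on the determining set"* — but with the constraint read on a BOND-LEVEL determining datum `𝔅 : BDetSet P` (node00-def-RR-2's F0a
`B15DeterminingSetsB`: `AgreeOnB`, `IsMinimizerB`, `DetBackgroundB`), so that PRINT's datum [II] (2.3) p. 224 — *"Λ_j = Ω_j^{(j)} ∖ Ω_{j+1}^{(j)} … (2.3)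
for the sets of sites and the sets of bonds"* (ruling (α) of record: the DIFFERENCE of the bond sets, `lamBondsSeq Ω k`) — can be fed to it.
HONESTY GUARD (№338 (5)): this is the print-datum twin of `solvableDom ∕ SelSpec ∕ UminOfRecord ∕ bgOfRecord` (FLAG №16 ∕ LOCATE-HSEAM
5d3298b8d191f169); the (b)-instance `solvableDom ∕ SelSpec ∕ UminOfRecord ∕ bgOfRecord` stays landed and true on its own text — and is RECOVERED
from the twin DEFINITIONALLY at the datum `bondsDet 𝔹` (§2: `solvableDomB_bondsDet`, `UminOfRecordB_bondsDet`, `rfl`).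

LAYOUT.  §1 the twin, declaration for declaration (names = FILE 1's with `B` on the datum-reading token; argument order identical):
`solvableDomB`, `mem_solvableDomB_iff`, `SelSpecB`, `UminOfRecordB`, `isMinimizerB_UminOfRecordB`, `UminOfRecordB_of_not`,
`UminOfRecordB_congr_of_isMinimizerB_iff₀`, `UminOfRecordB_congr_of_agreeOnB` (NEW face: the map reads `W` on `𝔅` only),
`measurable_UminOfRecordB_of_exists_selSpecB`, `predLiftB`, `predLiftB_apply_isMinimizerB`, `exists_selSpecB_of_selector`,
`measurable_UminOfRecordB_of_selector`, `bgOfRecordB : DetBackgroundB` (+ `_U ∕ _dom ∕ _reg`).  §2 the (b)-instance recovered: `isMinimizer_eq_isMinimizerB_bondsDet`,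
`solvableDomB_bondsDet`, `selSpecB_bondsDet_iff`, `UminOfRecordB_bondsDet`, `bgOfRecordB_toDetBackground`.

WHAT THIS FILE IS NOT.  Nothing of Bałaban's is asserted: no existence of minimisers ([15] Thm 1), no bound; the junk branch (unit configuration off
the solvable set) is a typing convention as in FILE 1.  Purely ADDITIVE: no existing declaration is touched; the record (`Record13CoP.UbgOfRecord₁₃CoP`)
is NOT re-pointed by this file (that is Stage 2's one body edit, filed separately in the gate8 window).  No `instance`, no `notation`, no `sorry`.
HONEST FRAMING: definitions of record; counts unmoved (8∕28 · K 1∕4); K0⁷ stub 1 NOT closed; finite 𝕋⁴ at fixed ε; NOT continuum ∕ OS ∕ mass-gap ∕ Clay.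
-/

noncomputable section

open MeasureTheory

namespace Literature.MathematicalPhysics.QuantumFieldTheory.Balaban1983to89.Node00

open T4Continuum B15DeterminingSets B15DeterminingSetsB

/-! ## §1  The solution map of (2.12) over a bond-level datum, as a TOTAL function -/

section SolutionMapB

variable {P : Params} {G : Type*} [GaugeGroup G] (av : ∀ j, Averaging P j G) (reg : Set (GaugeField P 0 G))

/-- The solvable set of (2.12) for the bond-level datum `𝔅`: the data `W` admitting a minimiser in the class `reg` under the averaging
constraints on the bonds of `𝔅` ([15] Thm 1 says it contains the regular data; not asserted).  Print-datum twin of `solvableDom`; the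
(b)-instance `solvableDom` stays landed and true on its own text. [cite: Balaban1988Convergent, (2.12) p.256] -/
def solvableDomB (𝔅 : BDetSet P) : Set (MSField P G) :=
  {W | ∃ U₀, IsMinimizerB av reg 𝔅 W U₀}

/-- Membership in the solvable set. [cite: Balaban1988Convergent, (2.12) p.256 (bookkeeping)] -/
theorem mem_solvableDomB_iff (𝔅 : BDetSet P) (W : MSField P G) :
    W ∈ solvableDomB av reg 𝔅 ↔ ∃ U₀, IsMinimizerB av reg 𝔅 W U₀ := Iff.rfl

/-- The solvable set depends on the data only through its values on `𝔅`. [cite: Balaban1988Convergent, (2.12) p.256 (bookkeeping)] -/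
theorem mem_solvableDomB_congr_of_agreeOnB {𝔅 : BDetSet P} {W W' : MSField P G} (h : AgreeOnB 𝔅 W W') :
    W ∈ solvableDomB av reg 𝔅 ↔ W' ∈ solvableDomB av reg 𝔅 :=
  exists_congr fun U₀ => isMinimizerB_congr_data h U₀

variable [MeasurableSpace G]

/-- **ADMISSIBLE SELECTORS FED BY THE (2.12) PREDICATE**, bond-level datum: `W ↦ F(IsMinimizerB … 𝔅 W)` is MEASURABLE, picks a minimiser whenever
one exists, and returns the unit configuration otherwise.  Print-datum twin of `SelSpec`. [cite: Balaban1988Convergent, (2.12) p.256 (typing convention)] -/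
def SelSpecB (𝔅 : BDetSet P) (F : (GaugeField P 0 G → Prop) → GaugeField P 0 G) : Prop :=
  Measurable (fun W : MSField P G => F (IsMinimizerB av reg 𝔅 W)) ∧
    (∀ W : MSField P G, (∃ U₀, IsMinimizerB av reg 𝔅 W U₀) → IsMinimizerB av reg 𝔅 W (F (IsMinimizerB av reg 𝔅 W))) ∧
    (∀ W : MSField P G, ¬ (∃ U₀, IsMinimizerB av reg 𝔅 W U₀) → F (IsMinimizerB av reg 𝔅 W) = fun _ => 1)

open Classical in
/-- **The (2.12) solution map of record over a bond-level datum** `U(𝔅, W)`: [III] p. 256, verbatim: *"we consider the variational problem …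
for U regular … with the conditions M(U) = V on the determining set"* — here the determining set is a set of BONDS per level (`𝔅 j`), as in
print's (2.3) of [II] p. 224 — TOTALISED exactly as FILE 1's `UminOfRecord`: through an admissible predicate-fed measurable selector when one
exists, else a chosen minimiser when one exists, else the unit configuration (junk; typing convention).  Existence ∕ uniqueness-mod-gauge
([15] Thm 1) is NOT asserted.  Print-datum twin of `UminOfRecord` (FLAG №16 ∕ LOCATE-HSEAM 5d3298b8d191f169); the (b)-instance `UminOfRecord`
stays landed and true on its own text (`UminOfRecordB_bondsDet`). [cite: Balaban1988Convergent, (2.12) p.256; Balaban1984PropagatorsII, (2.3) p.224] -/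
def UminOfRecordB (𝔅 : BDetSet P) (W : MSField P G) : GaugeField P 0 G :=
  if h : ∃ F, SelSpecB av reg 𝔅 F then Classical.choose h (IsMinimizerB av reg 𝔅 W)
  else if h : ∃ U₀, IsMinimizerB av reg 𝔅 W U₀ then Classical.choose h else fun _ => 1

/-- On the solvable set the chosen configuration IS a minimiser of (2.12) over `𝔅` (by `Classical.choose_spec`; nothing of print asserted).
[cite: Balaban1988Convergent, (2.12) p.256] -/
theorem isMinimizerB_UminOfRecordB {𝔅 : BDetSet P} {W : MSField P G} (h : ∃ U₀, IsMinimizerB av reg 𝔅 W U₀) :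
    IsMinimizerB av reg 𝔅 W (UminOfRecordB av reg 𝔅 W) := by
  unfold UminOfRecordB
  split_ifs with hsel
  · exact (Classical.choose_spec hsel).2.1 W h
  · exact Classical.choose_spec h

/-- Off the solvable set the solution map of record is the unit configuration (the documented junk default).
[cite: Balaban1988Convergent, (2.12) p.256 (typing convention)] -/
theorem UminOfRecordB_of_not {𝔅 : BDetSet P} {W : MSField P G} (h : ¬ ∃ U₀, IsMinimizerB av reg 𝔅 W U₀) :
    UminOfRecordB av reg 𝔅 W = fun _ => 1 := by
  unfold UminOfRecordB
  split_ifs with hsel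
  · exact (Classical.choose_spec hsel).2.2 W h
  · rfl

/-- On the solvable set the solution map of record lies in the regular class. [cite: Balaban1988Convergent, (2.12) p.256] -/
theorem UminOfRecordB_mem_reg {𝔅 : BDetSet P} {W : MSField P G} (h : W ∈ solvableDomB av reg 𝔅) :
    UminOfRecordB av reg 𝔅 W ∈ reg :=
  (isMinimizerB_UminOfRecordB av reg h).mem_reg

/-- On the solvable set the solution map of record satisfies the averaging constraints on `𝔅`. [cite: Balaban1988Convergent, (2.12) p.256] -/
theorem agreeOnB_UminOfRecordB {𝔅 : BDetSet P} {W : MSField P G} (h : W ∈ solvableDomB av reg 𝔅) :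
    AgreeOnB 𝔅 (avgFamily av (UminOfRecordB av reg 𝔅 W)) W :=
  (isMinimizerB_UminOfRecordB av reg h).agreeOnB

/-- **`UminOfRecordB` IS A FUNCTION OF THE (2.12) PREDICATE** (by construction in both branches). [cite: Balaban1988Convergent, (2.12) p.256 (bookkeeping)] -/
theorem UminOfRecordB_congr_of_isMinimizerB_iff₀ {𝔅 : BDetSet P} {W W' : MSField P G}
    (h : ∀ U₀, IsMinimizerB av reg 𝔅 W U₀ ↔ IsMinimizerB av reg 𝔅 W' U₀) :
    UminOfRecordB av reg 𝔅 W = UminOfRecordB av reg 𝔅 W' := by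
  have hpred : IsMinimizerB av reg 𝔅 W = IsMinimizerB av reg 𝔅 W' := funext fun U₀ => propext (h U₀)
  unfold UminOfRecordB
  rw [hpred]

/-- **THE SOLUTION MAP READS THE DATA ON `𝔅` ONLY**: data agreeing on the bonds of `𝔅` have the same solution configuration (both branches).
NEW face relative to FILE 1 (there by way of `B14.Eq218Concrete` congruences). [cite: Balaban1988Convergent, (2.12) p.256 (bookkeeping)] -/
theorem UminOfRecordB_congr_of_agreeOnB {𝔅 : BDetSet P} {W W' : MSField P G} (h : AgreeOnB 𝔅 W W') :
    UminOfRecordB av reg 𝔅 W = UminOfRecordB av reg 𝔅 W' :=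
  UminOfRecordB_congr_of_isMinimizerB_iff₀ av reg fun U₀ => isMinimizerB_congr_data h U₀

/-- **THE MEASURABLE BRANCH**: if an admissible predicate-fed selector exists, the solution map of record IS MEASURABLE in the data `W`.
[cite: Balaban1988Convergent, (2.12) p.256 (typing convention)] -/
theorem measurable_UminOfRecordB_of_exists_selSpecB {𝔅 : BDetSet P} (h : ∃ F, SelSpecB av reg 𝔅 F) :
    Measurable (UminOfRecordB av reg 𝔅) := by
  have heq : UminOfRecordB av reg 𝔅 = fun W => Classical.choose h (IsMinimizerB av reg 𝔅 W) := by
    funext W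
    unfold UminOfRecordB
    rw [dif_pos h]
  rw [heq]
  exact (Classical.choose_spec h).1

/-- Lifting a `W`-fed selector `f` to a predicate-fed one: on a (2.12) predicate `p = IsMinimizerB … W₁` return `f W₁` (any such `W₁`), else the unit.
[cite: Balaban1988Convergent, (2.12) p.256 (typing convention)] -/
noncomputable def predLiftB (𝔅 : BDetSet P) (f : MSField P G → GaugeField P 0 G) (p : GaugeField P 0 G → Prop) : GaugeField P 0 G :=
  open Classical in
  if h : ∃ W₁ : MSField P G, IsMinimizerB av reg 𝔅 W₁ = p then f (Classical.choose h) else fun _ => 1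

omit [MeasurableSpace G] in
/-- On the predicate of `W`, the lift of a DETERMINED selector returns `f W`. [cite: Balaban1988Convergent, (2.12) p.256 (bookkeeping)] -/
theorem predLiftB_apply_isMinimizerB {𝔅 : BDetSet P} {f : MSField P G → GaugeField P 0 G}
    (hdet : ∀ W W' : MSField P G, (∀ U₀, IsMinimizerB av reg 𝔅 W U₀ ↔ IsMinimizerB av reg 𝔅 W' U₀) → f W = f W')
    (W : MSField P G) : predLiftB av reg 𝔅 f (IsMinimizerB av reg 𝔅 W) = f W := by
  have h : ∃ W₁ : MSField P G, IsMinimizerB av reg 𝔅 W₁ = IsMinimizerB av reg 𝔅 W := ⟨W, rfl⟩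
  unfold predLiftB
  rw [dif_pos h]
  exact hdet _ _ fun U₀ => by rw [Classical.choose_spec h]

/-- **A MEASURABLE, MINIMISING, UNIT-OFF-THE-SOLVABLE-SET, DETERMINED `W`-fed selector yields an admissible predicate-fed selector.**
[cite: Balaban1988Convergent, (2.12) p.256 (typing convention)] -/
theorem exists_selSpecB_of_selector {𝔅 : BDetSet P} (f : MSField P G → GaugeField P 0 G) (hf : Measurable f)
    (hmin : ∀ W : MSField P G, (∃ U₀, IsMinimizerB av reg 𝔅 W U₀) → IsMinimizerB av reg 𝔅 W (f W))
    (hjunk : ∀ W : MSField P G, ¬ (∃ U₀, IsMinimizerB av reg 𝔅 W U₀) → f W = 1)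
    (hdet : ∀ W W' : MSField P G, (∀ U₀, IsMinimizerB av reg 𝔅 W U₀ ↔ IsMinimizerB av reg 𝔅 W' U₀) → f W = f W') :
    ∃ F, SelSpecB av reg 𝔅 F := by
  have key : (fun W : MSField P G => predLiftB av reg 𝔅 f (IsMinimizerB av reg 𝔅 W)) = f :=
    funext (predLiftB_apply_isMinimizerB av reg hdet)
  refine ⟨predLiftB av reg 𝔅 f, ?_, ?_, ?_⟩
  · rw [key]; exact hf
  · intro W hW
    rw [predLiftB_apply_isMinimizerB av reg hdet W]
    exact hmin W hW
  · intro W hW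
    rw [predLiftB_apply_isMinimizerB av reg hdet W]
    exact hjunk W hW

/-- Hence: such a `W`-fed selector makes the solution map of record MEASURABLE. [cite: Balaban1988Convergent, (2.12) p.256 (typing convention)] -/
theorem measurable_UminOfRecordB_of_selector {𝔅 : BDetSet P} (f : MSField P G → GaugeField P 0 G) (hf : Measurable f)
    (hmin : ∀ W : MSField P G, (∃ U₀, IsMinimizerB av reg 𝔅 W U₀) → IsMinimizerB av reg 𝔅 W (f W))
    (hjunk : ∀ W : MSField P G, ¬ (∃ U₀, IsMinimizerB av reg 𝔅 W U₀) → f W = 1)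
    (hdet : ∀ W W' : MSField P G, (∀ U₀, IsMinimizerB av reg 𝔅 W U₀ ↔ IsMinimizerB av reg 𝔅 W' U₀) → f W = f W') :
    Measurable (UminOfRecordB av reg 𝔅) :=
  measurable_UminOfRecordB_of_exists_selSpecB av reg (exists_selSpecB_of_selector av reg f hf hmin hjunk hdet)

/-- **The (2.12) solution datum of record over bond-level data** as F0a's `DetBackgroundB`: regularity class `reg`, domain = the solvable set,
`U` = the solution map of record, minimising property PROVED on the domain.  Print-datum twin of `bgOfRecord`. [cite: Balaban1988Convergent, (2.12) p.256] -/
def bgOfRecordB : DetBackgroundB P G av where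
  reg := reg
  dom := solvableDomB av reg
  U := UminOfRecordB av reg
  isMinimizer := fun _ _ h => isMinimizerB_UminOfRecordB av reg h

/-- Unfolding: the solution map of the datum of record. [cite: Balaban1988Convergent, (2.12) p.256 (bookkeeping)] -/
theorem bgOfRecordB_U : (bgOfRecordB av reg).U = UminOfRecordB av reg := rfl

/-- Unfolding: the domain of the datum of record is the solvable set. [cite: Balaban1988Convergent, (2.12) p.256 (bookkeeping)] -/
theorem bgOfRecordB_dom : (bgOfRecordB av reg).dom = solvableDomB av reg := rfl

/-- Unfolding: the regularity class of the datum of record. [cite: Balaban1988Convergent, (2.12) p.256 (bookkeeping)] -/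
theorem bgOfRecordB_reg : (bgOfRecordB av reg).reg = reg := rfl

end SolutionMapB

/-! ## §2  The (b)-instance recovered DEFINITIONALLY at `bondsDet 𝔹` (honesty guard №338 (5): the (b) objects stay landed and true) -/

section BondsDetInstance

variable {P : Params} {G : Type*} [GaugeGroup G] (av : ∀ j, Averaging P j G) (reg : Set (GaugeField P 0 G))

/-- The site-level (2.12) predicate IS the bond-level one at `bondsDet 𝔹`, as a function of `(V, U₀)` — `rfl` (F0a's
`isMinimizer_iff_isMinimizerB`, pointwise). [cite: Balaban1988Convergent, (2.12) p.256] -/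
theorem isMinimizer_eq_isMinimizerB_bondsDet (𝔹 : DetSet P) :
    IsMinimizer av reg 𝔹 = IsMinimizerB av reg (bondsDet 𝔹) := rfl

/-- The (b) solvable set IS the bond-level one at `bondsDet 𝔹`. [cite: Balaban1988Convergent, (2.12) p.256 (bookkeeping)] -/
theorem solvableDomB_bondsDet (𝔹 : DetSet P) : solvableDomB av reg (bondsDet 𝔹) = solvableDom av reg 𝔹 := rfl

variable [MeasurableSpace G]

/-- The (b) selector specification IS the bond-level one at `bondsDet 𝔹`. [cite: Balaban1988Convergent, (2.12) p.256 (bookkeeping)] -/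
theorem selSpecB_bondsDet_iff (𝔹 : DetSet P) (F : (GaugeField P 0 G → Prop) → GaugeField P 0 G) :
    SelSpecB av reg (bondsDet 𝔹) F ↔ SelSpec av reg 𝔹 F := Iff.rfl

/-- **THE (b) SOLUTION MAP OF RECORD IS THE BOND-LEVEL ONE AT `bondsDet 𝔹`** — `rfl`: `UminOfRecord` (FILE 1, the background every (b)-statement of the
tree is about) is untouched and is an INSTANCE of the twin. [cite: Balaban1988Convergent, (2.12) p.256 (bookkeeping)] -/
theorem UminOfRecordB_bondsDet (𝔹 : DetSet P) : UminOfRecordB av reg (bondsDet 𝔹) = UminOfRecord av reg 𝔹 := rfl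

/-- The (b) datum of record is the pull-back (`DetBackgroundB.toDetBackground`, F0a) of the bond-level datum of record. [cite: Balaban1988Convergent, (2.12)–(2.13) pp.256–257 (bookkeeping)] -/
theorem bgOfRecordB_toDetBackground : (bgOfRecordB av reg).toDetBackground = bgOfRecord av reg := rfl

end BondsDetInstance

end Literature.MathematicalPhysics.QuantumFieldTheory.Balaban1983to89.Node00

end
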